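import Literature.AnabelianGeometry.AbsoluteAnabelian.AbsTopICuspCountDictionaryProofs
import Literature.AnabelianGeometry.SemiGraphs.PSCSmoothCurveCuspidalCharacterization
import HarnessLib

/-!
# [AbsTopI] Lemma 4.5 (iv)–(v) sub-DAG (rows B1, B3, B4, B5, C1, C2, C3) UNCONDITIONAL at
# genuine pro-`l` smooth-curve data; model witness for F-0216 / F-0213

S. Mochizuki, *Topics in Absolute Anabelian Geometry I: Generalities* [AbsTopI] (J. Math. Sci. Univ.
Tokyo 19 (2012); kurims manuscript `paper:url-11ac98ba15fc`), Lemma 4.5 (iv) p. 54 as AMENDED in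
[IUTchI] Rmk 1.2.2 (ii) p. 40 ("the decomposition groups of cusps `⊆ H_*` may be characterized as the
maximal closed subgroups `I ⊆ H_*` isomorphic to `ℤ_l` which satisfy …") and (v) p. 55 ("the set of
cusps … is in natural bijective correspondence with the set of conjugacy classes in `H_*` of
decomposition groups of cusps"); printed proof p. 55 l. 13–19: "(iv) is [in light of assertion (iii)]
precisely a summary of the argument of [CombGC], Theorem 1.6, (i) … (v), (vi) follow immediately from
[CombGC], Proposition 1.2, (i), (ii)".

PROOF-ONLY companion (no definition, no instance, no notation) of the cell's sub-DAG
`plan/L4/SUBDAG-AbsTopI-Lem45.md` (abc-iut; trunk `AbsTopIChains.lean`, FACT-LIST rows F-0213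
`IsMaximalCuspidalCandidate`, F-0216 `SatisfiesCuspidalCriterion`).  State of the sub-DAG before this
file: rows B4 (`InertiaIffMaximalTotRam`), B1 (`InertiaProcyclic`), B5 (`Lem45ivCharacterisation`),
C1 (`DistinctCuspsNotCommensurable`), C2 (`InertiaCommensurablyTerminal`), C3 (`CuspsBijInertiaClasses`)
are PROVED at the cusp-inertia data `CuspInertiaData.ofPSC G` of a pro-`{l}` PSC datum `G` ONLY
RELATIVE to layer L3's NAMED [CombGC] predicates on `G` (`PSCDatum.CuspidalEdgeLikeCharacterization` =
[IUTchI] Rmk 1.2.3 (iv); `EdgeLikeOpenInterDeterminesEdge` = Prop 1.2 (i); `VerticialEdgeLikeCommensurablyTerminal`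
= Prop 1.2 (ii)) — abc-iut-w5-d062 p415186, abc-iut-L4-t6 p416704, abc-iut-L4-t15 p416137 / p417070,
abc-iut-L4-t4 `AbsTopICuspCountDictionaryProofs`.  At PSC data of SMOOTH-CURVE SHAPE (abc-iut-L3-t4
`PSCSmoothCurveShape.lean`: one vertex, no node, `Π_v = Π`, cusp groups the closed cusp inertia groups
`closure ι⟨c_j⟩` of a profinite pro-`Σ` completion `ι : Γ_{g,r} → Π` of a hyperbolic punctured surface
group) those three predicates are THEOREMS of the tree (`cuspidalEdgeLikeCharacterization_of_smoothCurve`,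
abc-iut-f-164; `edgeLikeOpenInterDeterminesEdge_of_smoothCurve`, `commensurablyTerminal_of_smoothCurve`,
abc-iut-L3-t4 — all resting on the malnormality theorem `proSigmaCuspInertiaMalnormal_holds` for cusp
inertia in pro-`Σ` completions of surface groups).  This file COMPOSES:

* §A (`…_of_smoothCurve`): B1, B4, C1, C2, C3 at `ofPSC G` for every smooth-curve datum with
  `Σ_G = {l}` — NO [CombGC] hypothesis left; B5 = Lemma 4.5 (iv) [amended] modulo ONLY the cusp-count
  dictionary B2 (`r = d + 1`), and HYPOTHESIS-FREE for the geometric count `d(V) := r(G_V) − 1`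
  (`isCuspidal_iff_isMaximalCuspidalCandidate_of_smoothCurve`: the cuspidal subgroups of `Π` are EXACTLY
  the maximal closed `I ≅ ℤ_l` with `r(I^l·J) < l · r(I·J)` for every characteristic open `J ≠ I·J` —
  [CombGC] Thm 1.6 (i) in the language of [AbsTopI] Lem 4.5 (iv)); the canonical representation-theoretic
  count `d(V) := d_{χ^{cyclo}}(ρ_V)` modulo (iii) only (`…_canonical_of_smoothCurve`);
* §B: every cusp group `closure ι⟨c_j⟩` SATISFIES the amended cuspidal criterion and is a MAXIMAL
  candidate (`isMaximalCuspidalCandidate_cuspGp_of_smoothCurve`);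
* §C (`exists_smoothCurve_lem45iv_model`): for every prime `l` and every hyperbolic type `(g, r)` with
  `r ≥ 1` such a datum EXISTS (`Π` := a pro-`{l}` completion of `Γ_{g,r}`, [SemiAnbd] Ex 2.10
  `exists_isProSigmaCompletion`), so FACT-LIST rows F-0216 / F-0213 are MODEL-WITNESSED at genuine
  surface-group data WITH cusps (in particular at the once-punctured type `(1, 1)` and the tripod `(0, 3)`).

HONEST FRAMING: refereed pre-IUT anabelian group theory ([AbsTopI], [CombGC]); instance forms at
genuine ONE-COMPONENT data (the printed Lemma 4.5 concerns the geometric fundamental group of an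
arbitrary hyperbolic orbicurve; (iii) — weights of Frobenius, [CombGC] §2 — stays an INPUT where the
canonical count is used); a FACT row is an assumption label on OUR typing; typed ≠ proved elsewhere;
nothing here bears on [IUTchIII] Cor 3.12 and nothing here is an abc claim.
-/

noncomputable section

open scoped Pointwise

namespace Literature.AnabelianGeometry.AbsoluteAnabelian.FundamentalExtension

open Literature.AnabelianGeometry.AbsoluteAnabelian.AbsTopI
open Literature.AnabelianGeometry.SemiGraphs
open Literature.AnabelianGeometry.SemiGraphs.SemiGraphOfAnabelioids (IsProSigmaCompletion)
open Literature.GroupTheory.CombinatorialGroupTheory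

universe u v w

/-! ## §A. The sub-DAG rows at `ofPSC G` for a smooth-curve datum `G` -/

section SmoothCurve

variable {P : Type u} [Group P] [TopologicalSpace P] [IsTopologicalGroup P] [CompactSpace P]
  [T2Space P] [TotallyDisconnectedSpace P]
variable {Sigma : Set ℕ} {g r l : ℕ}

/-- **Row B1 UNCONDITIONAL at smooth-curve data**: every cusp inertia subgroup of `H_* = Π` (a
conjugate of some `closure ι⟨c_j⟩`) is closed and `≅ ℤ_l` (`AbsTopII.IsFreeProSigmaCyclic {l}`), for a
smooth-curve datum with `Σ_G = {l}` — [CombGC] Rmk 1.1.3 "`Π_e ≅ Ẑ^Σ`" at this datum.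
[cite: MochizukiCombGC2007, Rmk 1.1.3 p.7] [cite: MochizukiAbsTopI2012, Lemma 4.5 (iv) p.54] -/
theorem CuspInertiaData.inertiaProcyclic_ofPSC_of_smoothCurve (hne : Sigma.Nonempty)
    (hprime : ∀ p ∈ Sigma, p.Prime) (hgr : PuncturedSurfaceGroup.IsHyperbolicType g r)
    (ι : PuncturedSurfaceGroup g r →* P) (hι : IsProSigmaCompletion Sigma ι) (G : PSCDatum P)
    (e : G.graph.C ≃ Fin r)
    (hC : ∀ c, G.cuspGp c =
      ((PuncturedSurfaceGroup.cuspInertia (g := g) (e c)).map ι).topologicalClosure)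
    (hS : G.Sigma = {l}) :
    (CuspInertiaData.ofPSC G).InertiaProcyclic l :=
  CuspInertiaData.inertiaProcyclic_ofPSC_of_cuspidalEdgeLikeCharacterization G hS
    (G.cuspidalEdgeLikeCharacterization_of_smoothCurve hne hprime hgr ι hι e hC)

/-- **Row B4 UNCONDITIONAL at smooth-curve data** ("precisely a summary of the argument of [CombGC],
Theorem 1.6, (i)"): for a smooth-curve datum with `Σ_G = {l}` and at least one cusp, the cusp inertia
subgroups of `Π` are EXACTLY the maximal closed `I ≅ ℤ_l` such that for every characteristic open `J`
with `J ≠ I·J` the covering `J ⊆ I·J` is totally ramified at some cusp.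
[cite: MochizukiAbsTopI2012, Lemma 4.5 (iv) p.54] [cite: MochizukiCombGC2007, Thm. 1.6 (i) proof p.14] -/
theorem CuspInertiaData.inertiaIffMaximalTotRam_ofPSC_of_smoothCurve (hne : Sigma.Nonempty)
    (hprime : ∀ p ∈ Sigma, p.Prime) (hgr : PuncturedSurfaceGroup.IsHyperbolicType g r)
    (ι : PuncturedSurfaceGroup g r →* P) (hι : IsProSigmaCompletion Sigma ι) (G : PSCDatum P)
    (e : G.graph.C ≃ Fin r)
    (hC : ∀ c, G.cuspGp c =
      ((PuncturedSurfaceGroup.cuspInertia (g := g) (e c)).map ι).topologicalClosure)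
    (hS : G.Sigma = {l}) (hr : 0 < r) :
    (CuspInertiaData.ofPSC G).InertiaIffMaximalTotRam l :=
  CuspInertiaData.inertiaIffMaximalTotRam_ofPSC_of_cuspidalEdgeLikeCharacterization G hS
    ⟨e.symm ⟨0, hr⟩⟩ (G.cuspidalEdgeLikeCharacterization_of_smoothCurve hne hprime hgr ι hι e hC)

/-- **Row B5 = [AbsTopI] Lemma 4.5 (iv) [amended] at smooth-curve data, modulo ONLY the cusp-count
dictionary B2** (`r(V) = d(V) + 1` on open `V`, i.e. Lemma 4.5 (iii), third sentence): the cusp inertia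
subgroups of `Π` are exactly the maximal cuspidal candidates `IsMaximalCuspidalCandidate l d`.
[cite: MochizukiAbsTopI2012, Lemma 4.5 (iv) p.54] [cite: Mochizuki2012, IUTchI Rmk 1.2.2 (ii) p.40] -/
theorem CuspInertiaData.lem45ivCharacterisation_ofPSC_of_smoothCurve (hne : Sigma.Nonempty)
    (hprime : ∀ p ∈ Sigma, p.Prime) (hgr : PuncturedSurfaceGroup.IsHyperbolicType g r)
    (ι : PuncturedSurfaceGroup g r →* P) (hι : IsProSigmaCompletion Sigma ι) (G : PSCDatum P)
    (e : G.graph.C ≃ Fin r)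
    (hC : ∀ c, G.cuspGp c =
      ((PuncturedSurfaceGroup.cuspInertia (g := g) (e c)).map ι).topologicalClosure)
    (hS : G.Sigma = {l}) (hr : 0 < r)
    (d : CuspCountData P) (hd : CuspCountDictionary d (CuspInertiaData.ofPSC G).r) :
    (CuspInertiaData.ofPSC G).Lem45ivCharacterisation l d :=
  CuspInertiaData.lem45ivCharacterisation_ofPSC G hS ⟨e.symm ⟨0, hr⟩⟩
    (G.cuspidalEdgeLikeCharacterization_of_smoothCurve hne hprime hgr ι hι e hC) d hd

omit [T2Space P] [TotallyDisconnectedSpace P] in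
/-- The GEOMETRIC cusp-count data `d(V) := r(G_V) − 1` satisfies the dictionary `r = d + 1` at any
PSC datum with a cusp (every covering has a cusp: `r(G_V) ≥ 1`).
[cite: MochizukiAbsTopI2012, Lemma 4.5 (iii)(iv) p.54] -/
theorem cuspCountDictionary_geometric (G : PSCDatum P) (e : G.graph.C ≃ Fin r) (hr : 0 < r) :
    CuspCountDictionary ⟨fun V => G.cuspCount V - 1⟩ (CuspInertiaData.ofPSC G).r := by
  intro V hV
  have hpos := cuspCount_pos_of_isOpen G ⟨e.symm ⟨0, hr⟩⟩ V hV
  change G.cuspCount V = G.cuspCount V - 1 + 1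
  omega

/-- **[AbsTopI] Lemma 4.5 (iv) [amended] at smooth-curve data for the GEOMETRIC count — NO
hypothesis** beyond the shape: with `d(V) := r(G_V) − 1`, the cusp inertia subgroups of `Π` are
exactly the maximal closed `I ≅ ℤ_l` with `d(I^l·J) + 1 < l·(d(I·J) + 1)`, i.e. `r(I^l·J) < l·r(I·J)`,
for every characteristic open `J ≠ I·J` ([CombGC] Thm 1.6 (i) in the language of Lemma 4.5 (iv)).
[cite: MochizukiAbsTopI2012, Lemma 4.5 (iv) p.54] [cite: MochizukiCombGC2007, Thm 1.6(i) p.13] -/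
theorem CuspInertiaData.lem45ivCharacterisation_ofPSC_of_smoothCurve_geometric (hne : Sigma.Nonempty)
    (hprime : ∀ p ∈ Sigma, p.Prime) (hgr : PuncturedSurfaceGroup.IsHyperbolicType g r)
    (ι : PuncturedSurfaceGroup g r →* P) (hι : IsProSigmaCompletion Sigma ι) (G : PSCDatum P)
    (e : G.graph.C ≃ Fin r)
    (hC : ∀ c, G.cuspGp c =
      ((PuncturedSurfaceGroup.cuspInertia (g := g) (e c)).map ι).topologicalClosure)
    (hS : G.Sigma = {l})
    (hr : 0 < r) :
    (CuspInertiaData.ofPSC G).Lem45ivCharacterisation l ⟨fun V => G.cuspCount V - 1⟩ :=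
  CuspInertiaData.lem45ivCharacterisation_ofPSC_of_smoothCurve hne hprime hgr ι hι G e hC hS hr _
    (cuspCountDictionary_geometric G e hr)

/-- Pointwise form: at a smooth-curve datum with `Σ_G = {l}` and a cusp, a subgroup `I ⊆ Π` is one of
layer L3's CUSPIDAL subgroups (a conjugate of some `closure ι⟨c_j⟩`) iff it is a maximal cuspidal
candidate for the geometric count. [cite: MochizukiAbsTopI2012, Lemma 4.5 (iv) p.54] -/
theorem CuspInertiaData.isCuspidal_iff_isMaximalCuspidalCandidate_of_smoothCurve (hne : Sigma.Nonempty)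
    (hprime : ∀ p ∈ Sigma, p.Prime) (hgr : PuncturedSurfaceGroup.IsHyperbolicType g r)
    (ι : PuncturedSurfaceGroup g r →* P) (hι : IsProSigmaCompletion Sigma ι) (G : PSCDatum P)
    (e : G.graph.C ≃ Fin r)
    (hC : ∀ c, G.cuspGp c =
      ((PuncturedSurfaceGroup.cuspInertia (g := g) (e c)).map ι).topologicalClosure)
    (hS : G.Sigma = {l})
    (hr : 0 < r) (I : Subgroup P) :
    G.IsCuspidal I ↔ IsMaximalCuspidalCandidate l ⟨fun V => G.cuspCount V - 1⟩ I :=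
  CuspInertiaData.isCuspidal_iff_isMaximalCuspidalCandidate G hS ⟨e.symm ⟨0, hr⟩⟩
    (G.cuspidalEdgeLikeCharacterization_of_smoothCurve hne hprime hgr ι hι e hC) _
    (cuspCountDictionary_geometric G e hr) I

/-- **[AbsTopI] Lemma 4.5 (iv) [amended] at smooth-curve data for the CANONICAL count
`d(V) := d_{χ^{cyclo}}(ρ_V)`, modulo (iii) ONLY**: given a family of `G_k`-representations `ρ_V` (the
printed `V^{ab} ⊗ ℚ_l`) satisfying Lemma 4.5 (iii), third sentence, for the cusp numbers `r(G_V)`, the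
cusp inertia subgroups are exactly the maximal candidates for `d_{χ^{cyclo}}` — layer L3's
characterisation is no longer a hypothesis. [cite: MochizukiAbsTopI2012, Lemma 4.5 (iii)(iv) p.54] -/
theorem CuspInertiaData.lem45ivCharacterisation_ofPSC_canonical_of_smoothCurve (hne : Sigma.Nonempty)
    (hprime : ∀ p ∈ Sigma, p.Prime) (hgr : PuncturedSurfaceGroup.IsHyperbolicType g r)
    (ι : PuncturedSurfaceGroup g r →* P) (hι : IsProSigmaCompletion Sigma ι) (G : PSCDatum P)
    (e : G.graph.C ≃ Fin r)
    (hC : ∀ c, G.cuspGp c =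
      ((PuncturedSurfaceGroup.cuspInertia (g := g) (e c)).map ι).topologicalClosure)
    (hS : G.Sigma = {l})
    (hr : 0 < r) {Gk : Type u} [Group Gk] [TopologicalSpace Gk] {K : Type v} [Field K]
    {W : Subgroup P → Type w} [∀ V, AddCommGroup (W V)] [∀ V, Module K (W V)] (χcyclo : Gk →* Kˣ)
    (ρ : ∀ V : Subgroup P, Gk →* (W V ≃ₗ[K] W V))
    (h3 : ∀ V : Subgroup P, IsOpen (V : Set P) → Lem45iii_cuspCount χcyclo (ρ V) (G.cuspCount V)) :
    (CuspInertiaData.ofPSC G).Lem45ivCharacterisation l ⟨fun V => (dChi (ρ V) χcyclo).toNat⟩ :=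
  CuspInertiaData.lem45ivCharacterisation_ofPSC_canonical G hS ⟨e.symm ⟨0, hr⟩⟩
    (G.cuspidalEdgeLikeCharacterization_of_smoothCurve hne hprime hgr ι hι e hC) χcyclo ρ h3

/-- Pointwise canonical form, modulo (iii) only. [cite: MochizukiAbsTopI2012, Lemma 4.5 (iii)(iv) p.54] -/
theorem CuspInertiaData.isCuspidal_iff_isMaximalCuspidalCandidate_canonical_of_smoothCurve (hne : Sigma.Nonempty)
    (hprime : ∀ p ∈ Sigma, p.Prime) (hgr : PuncturedSurfaceGroup.IsHyperbolicType g r)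
    (ι : PuncturedSurfaceGroup g r →* P) (hι : IsProSigmaCompletion Sigma ι) (G : PSCDatum P)
    (e : G.graph.C ≃ Fin r)
    (hC : ∀ c, G.cuspGp c =
      ((PuncturedSurfaceGroup.cuspInertia (g := g) (e c)).map ι).topologicalClosure)
    (hS : G.Sigma = {l}) (hr : 0 < r) {Gk : Type u} [Group Gk] [TopologicalSpace Gk] {K : Type v}
    [Field K] {W : Subgroup P → Type w} [∀ V, AddCommGroup (W V)] [∀ V, Module K (W V)]
    (χcyclo : Gk →* Kˣ) (ρ : ∀ V : Subgroup P, Gk →* (W V ≃ₗ[K] W V))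
    (h3 : ∀ V : Subgroup P, IsOpen (V : Set P) → Lem45iii_cuspCount χcyclo (ρ V) (G.cuspCount V))
    (I : Subgroup P) :
    G.IsCuspidal I ↔ IsMaximalCuspidalCandidate l ⟨fun V => (dChi (ρ V) χcyclo).toNat⟩ I :=
  CuspInertiaData.isCuspidal_iff_isMaximalCuspidalCandidate_canonical G hS ⟨e.symm ⟨0, hr⟩⟩
    (G.cuspidalEdgeLikeCharacterization_of_smoothCurve hne hprime hgr ι hι e hC) χcyclo ρ h3 I

/-- **Row C1 UNCONDITIONAL at smooth-curve data** ([CombGC] Prop 1.2 (i), edge-like case): cusp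
inertia subgroups of distinct cusps are not commensurable.
[cite: MochizukiCombGC2007, Prop 1.2(i) p.8] [cite: MochizukiAbsTopI2012, Lemma 4.5 (v) p.55] -/
theorem CuspInertiaData.distinctCuspsNotCommensurable_ofPSC_of_smoothCurve (hne : Sigma.Nonempty)
    (hprime : ∀ p ∈ Sigma, p.Prime) (hgr : PuncturedSurfaceGroup.IsHyperbolicType g r)
    (ι : PuncturedSurfaceGroup g r →* P) (hι : IsProSigmaCompletion Sigma ι) (G : PSCDatum P)
    (e : G.graph.C ≃ Fin r)
    (hC : ∀ c, G.cuspGp c =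
      ((PuncturedSurfaceGroup.cuspInertia (g := g) (e c)).map ι).topologicalClosure)
    [IsEmpty G.graph.N] :
    (CuspInertiaData.ofPSC G).DistinctCuspsNotCommensurable :=
  CuspInertiaData.distinctCuspsNotCommensurable_ofPSC G
    (G.edgeLikeOpenInterDeterminesEdge_of_smoothCurve hne hprime hgr ι hι e hC)

/-- **Row C3 = [AbsTopI] Lemma 4.5 (v), first sentence, UNCONDITIONAL at smooth-curve data**: cusps of
the covering ↔ `Π`-conjugacy classes of cusp inertia subgroups is a bijection.
[cite: MochizukiAbsTopI2012, Lemma 4.5 (v) p.55] [cite: MochizukiCombGC2007, Prop 1.2(i) p.8] -/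
theorem CuspInertiaData.cuspsBijInertiaClasses_ofPSC_of_smoothCurve (hne : Sigma.Nonempty)
    (hprime : ∀ p ∈ Sigma, p.Prime) (hgr : PuncturedSurfaceGroup.IsHyperbolicType g r)
    (ι : PuncturedSurfaceGroup g r →* P) (hι : IsProSigmaCompletion Sigma ι) (G : PSCDatum P)
    (e : G.graph.C ≃ Fin r)
    (hC : ∀ c, G.cuspGp c =
      ((PuncturedSurfaceGroup.cuspInertia (g := g) (e c)).map ι).topologicalClosure)
    [IsEmpty G.graph.N] :
    (CuspInertiaData.ofPSC G).CuspsBijInertiaClasses :=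
  CuspInertiaData.cuspsBijInertiaClasses_ofPSC G
    (G.edgeLikeOpenInterDeterminesEdge_of_smoothCurve hne hprime hgr ι hι e hC)

/-- **Row C2 UNCONDITIONAL at smooth-curve data** ([CombGC] Prop 1.2 (ii)): every cusp inertia
subgroup of `Π` is commensurably terminal (malnormality of cusp inertia, [SemiAnbd] Ex 2.10).
[cite: MochizukiCombGC2007, Prop 1.2(ii) p.8] [cite: MochizukiAbsTopI2012, Lemma 4.5 (v)(vi) p.55] -/
theorem CuspInertiaData.inertiaCommensurablyTerminal_ofPSC_of_smoothCurve (hne : Sigma.Nonempty)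
    (hprime : ∀ p ∈ Sigma, p.Prime) (hgr : PuncturedSurfaceGroup.IsHyperbolicType g r)
    (ι : PuncturedSurfaceGroup g r →* P) (hι : IsProSigmaCompletion Sigma ι) (G : PSCDatum P)
    (e : G.graph.C ≃ Fin r)
    (hC : ∀ c, G.cuspGp c =
      ((PuncturedSurfaceGroup.cuspInertia (g := g) (e c)).map ι).topologicalClosure)
    [IsEmpty G.graph.N]
    (hV : ∀ v, G.vertGp v = ⊤) (v₀ : G.graph.V) :
    (CuspInertiaData.ofPSC G).InertiaCommensurablyTerminal :=
  CuspInertiaData.inertiaCommensurablyTerminal_ofPSC G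
    (G.commensurablyTerminal_of_smoothCurve hne hprime hgr ι hι e hC hV v₀).1

/-! ## §B. The cusp groups themselves are maximal cuspidal candidates -/

/-- **Every cusp group `closure ι⟨c_j⟩` of a smooth-curve datum (with `Σ_G = {l}`, `r ≥ 1`) SATISFIES the
amended cuspidal criterion of [AbsTopI] Lemma 4.5 (iv) and is a MAXIMAL such subgroup**, for the
geometric count `d(V) := r(G_V) − 1` — an instance of FACT-LIST rows F-0216 / F-0213 at genuine data.
[cite: MochizukiAbsTopI2012, Lemma 4.5 (iv) p.54] [cite: Mochizuki2012, IUTchI Rmk 1.2.2 (ii) p.40] -/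
theorem isMaximalCuspidalCandidate_cuspGp_of_smoothCurve (hne : Sigma.Nonempty)
    (hprime : ∀ p ∈ Sigma, p.Prime) (hgr : PuncturedSurfaceGroup.IsHyperbolicType g r)
    (ι : PuncturedSurfaceGroup g r →* P) (hι : IsProSigmaCompletion Sigma ι) (G : PSCDatum P)
    (e : G.graph.C ≃ Fin r)
    (hC : ∀ c, G.cuspGp c =
      ((PuncturedSurfaceGroup.cuspInertia (g := g) (e c)).map ι).topologicalClosure)
    (hS : G.Sigma = {l}) (hr : 0 < r)
    (c : G.graph.C) :
    IsMaximalCuspidalCandidate l ⟨fun V => G.cuspCount V - 1⟩ (G.cuspGp c) :=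
  (CuspInertiaData.isCuspidal_iff_isMaximalCuspidalCandidate_of_smoothCurve hne hprime hgr ι hι G e hC
    hS hr (G.cuspGp c)).mp ⟨c, 1, (one_smul _ _).symm⟩

/-- In particular every cusp group satisfies the criterion (`SatisfiesCuspidalCriterion`, F-0216).
[cite: MochizukiAbsTopI2012, Lemma 4.5 (iv) p.54] -/
theorem satisfiesCuspidalCriterion_cuspGp_of_smoothCurve (hne : Sigma.Nonempty)
    (hprime : ∀ p ∈ Sigma, p.Prime) (hgr : PuncturedSurfaceGroup.IsHyperbolicType g r)
    (ι : PuncturedSurfaceGroup g r →* P) (hι : IsProSigmaCompletion Sigma ι) (G : PSCDatum P)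
    (e : G.graph.C ≃ Fin r)
    (hC : ∀ c, G.cuspGp c =
      ((PuncturedSurfaceGroup.cuspInertia (g := g) (e c)).map ι).topologicalClosure)
    (hS : G.Sigma = {l}) (hr : 0 < r)
    (c : G.graph.C) :
    SatisfiesCuspidalCriterion l ⟨fun V => G.cuspCount V - 1⟩ (G.cuspGp c) :=
  (isMaximalCuspidalCandidate_cuspGp_of_smoothCurve hne hprime hgr ι hι G e hC hS hr c).1

/-- And every conjugate `γ • closure ι⟨c_j⟩` is a maximal cuspidal candidate.
[cite: MochizukiAbsTopI2012, Lemma 4.5 (iv) p.54] -/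
theorem isMaximalCuspidalCandidate_conj_cuspGp_of_smoothCurve (hne : Sigma.Nonempty)
    (hprime : ∀ p ∈ Sigma, p.Prime) (hgr : PuncturedSurfaceGroup.IsHyperbolicType g r)
    (ι : PuncturedSurfaceGroup g r →* P) (hι : IsProSigmaCompletion Sigma ι) (G : PSCDatum P)
    (e : G.graph.C ≃ Fin r)
    (hC : ∀ c, G.cuspGp c =
      ((PuncturedSurfaceGroup.cuspInertia (g := g) (e c)).map ι).topologicalClosure)
    (hS : G.Sigma = {l}) (hr : 0 < r)
    (c : G.graph.C) (γ : ConjAct P) :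
    IsMaximalCuspidalCandidate l ⟨fun V => G.cuspCount V - 1⟩ (γ • G.cuspGp c) :=
  (CuspInertiaData.isCuspidal_iff_isMaximalCuspidalCandidate_of_smoothCurve hne hprime hgr ι hι G e hC
    hS hr _).mp ⟨c, γ, rfl⟩

end SmoothCurve

/-! ## §C. Existence: the genuine pro-`l` datum of type `(g, r)` -/

/-- **Model witness for F-0216 / F-0213 and rows B1/B4/B5/C1/C2/C3 at GENUINE data.**  For every prime
`l` and every hyperbolic type `(g, r)` with `r ≥ 1` there is a profinite group `Π` — a pro-`{l}`
completion `ι : Γ_{g,r} → Π` of the punctured surface group ([SemiAnbd] Ex 2.10) — and a PSC datum `G`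
over `Π` of smooth-curve shape (`Σ_G = {l}`, one vertex with `Π_v = Π`, no node, `r` cusps with cusp
groups `closure ι⟨c_j⟩`) at which: every cusp group satisfies the amended cuspidal criterion and is a
maximal candidate (geometric count), the cuspidal subgroups are EXACTLY the maximal candidates
([AbsTopI] Lemma 4.5 (iv) [amended], both inclusions), and rows B1, B4, C1, C2, C3 of the sub-DAG hold.
[cite: MochizukiAbsTopI2012, Lemma 4.5 (iv)(v) pp.54-55] [cite: MochizukiCombGC2007, Thm 1.6(i) p.13] -/
theorem exists_smoothCurve_lem45iv_model (l : ℕ) (hl : l.Prime) (g r : ℕ)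
    (hgr : PuncturedSurfaceGroup.IsHyperbolicType g r) (hr : 0 < r) :
    ∃ (Q : ProfiniteGrp.{0}) (ι : PuncturedSurfaceGroup g r →* Q) (G : PSCDatum Q),
      IsProSigmaCompletion {l} ι ∧ G.Sigma = {l} ∧ IsEmpty G.graph.N ∧ (∀ v, G.vertGp v = ⊤) ∧
      (∃ e : G.graph.C ≃ Fin r, ∀ c, G.cuspGp c =
        ((PuncturedSurfaceGroup.cuspInertia (g := g) (e c)).map ι).topologicalClosure) ∧
      (∀ c, SatisfiesCuspidalCriterion l ⟨fun V => G.cuspCount V - 1⟩ (G.cuspGp c)) ∧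
      (∀ c, IsMaximalCuspidalCandidate l ⟨fun V => G.cuspCount V - 1⟩ (G.cuspGp c)) ∧
      (∀ I : Subgroup Q, G.IsCuspidal I ↔ IsMaximalCuspidalCandidate l ⟨fun V => G.cuspCount V - 1⟩ I) ∧
      (CuspInertiaData.ofPSC G).InertiaProcyclic l ∧
      (CuspInertiaData.ofPSC G).InertiaIffMaximalTotRam l ∧
      (CuspInertiaData.ofPSC G).Lem45ivCharacterisation l ⟨fun V => G.cuspCount V - 1⟩ ∧
      (CuspInertiaData.ofPSC G).DistinctCuspsNotCommensurable ∧
      (CuspInertiaData.ofPSC G).InertiaCommensurablyTerminal ∧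
      (CuspInertiaData.ofPSC G).CuspsBijInertiaClasses := by
  obtain ⟨Q, ι, hι⟩ :=
    IsProSigmaCompletion.exists_isProSigmaCompletion (PuncturedSurfaceGroup g r) ({l} : Set ℕ)
  let T : PSCDatum Q :=
    { Sigma := {l}
      sigma_prime := fun p hp => by rw [Set.mem_singleton_iff.mp hp]; exact hl
      sigma_nonempty := ⟨l, rfl⟩
      graph := { V := Unit, N := Empty, C := Fin r, nodeEnds := Empty.elim, cuspEnd := fun _ => () }
      vertGp := fun _ => ⊤
      nodeGp := Empty.elim
      cuspGp := fun i => ((PuncturedSurfaceGroup.cuspInertia (g := g) i).map ι).topologicalClosure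
      genus := fun _ => g
      isClosed_vertGp := fun _ => by rw [Subgroup.coe_top]; exact isClosed_univ
      isClosed_nodeGp := fun e => e.elim
      isClosed_cuspGp := fun _ => Subgroup.isClosed_topologicalClosure _
      nodeGp_le := fun e => e.elim
      cuspGp_le := fun _ => ⟨1, le_top⟩
      proSigma := PSCDatum.isProSigma_of_isProSigmaCompletion hι }
  haveI : IsEmpty T.graph.N := inferInstanceAs (IsEmpty Empty)
  have hne : ({l} : Set ℕ).Nonempty := Set.singleton_nonempty l
  have hprime : ∀ p ∈ ({l} : Set ℕ), p.Prime := fun p hp => by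
    rw [Set.mem_singleton_iff.mp hp]; exact hl
  have hC : ∀ c, T.cuspGp c =
      ((PuncturedSurfaceGroup.cuspInertia (g := g) ((Equiv.refl (Fin r)) c)).map ι).topologicalClosure :=
    fun _ => rfl
  have hS : T.Sigma = {l} := rfl
  have hV : ∀ v, T.vertGp v = ⊤ := fun _ => rfl
  refine ⟨Q, ι, T, hι, hS, inferInstance, hV, ⟨Equiv.refl _, hC⟩,
    satisfiesCuspidalCriterion_cuspGp_of_smoothCurve hne hprime hgr ι hι T _ hC hS hr,
    isMaximalCuspidalCandidate_cuspGp_of_smoothCurve hne hprime hgr ι hι T _ hC hS hr,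
    CuspInertiaData.isCuspidal_iff_isMaximalCuspidalCandidate_of_smoothCurve hne hprime hgr ι hι T _ hC
      hS hr,
    CuspInertiaData.inertiaProcyclic_ofPSC_of_smoothCurve hne hprime hgr ι hι T _ hC hS,
    CuspInertiaData.inertiaIffMaximalTotRam_ofPSC_of_smoothCurve hne hprime hgr ι hι T _ hC hS hr,
    CuspInertiaData.lem45ivCharacterisation_ofPSC_of_smoothCurve_geometric hne hprime hgr ι hι T _ hC
      hS hr,
    CuspInertiaData.distinctCuspsNotCommensurable_ofPSC_of_smoothCurve hne hprime hgr ι hι T _ hC,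
    CuspInertiaData.inertiaCommensurablyTerminal_ofPSC_of_smoothCurve hne hprime hgr ι hι T _ hC hV (),
    CuspInertiaData.cuspsBijInertiaClasses_ofPSC_of_smoothCurve hne hprime hgr ι hι T _ hC⟩

/-- The once-punctured type `(g, r) = (1, 1)` (the shape of a once-punctured elliptic curve `E ∖ {O}`,
the curves `X` of [IUTchI]): for every prime `l` there is a genuine pro-`l` surface-group datum with ONE
cusp at which the cusp group is a maximal cuspidal candidate and [AbsTopI] Lemma 4.5 (iv) [amended]
holds for the geometric count. [cite: MochizukiAbsTopI2012, Lemma 4.5 (iv) p.54] -/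
theorem exists_oncePunctured_lem45iv_model (l : ℕ) (hl : l.Prime) :
    ∃ (Q : ProfiniteGrp.{0}) (ι : PuncturedSurfaceGroup 1 1 →* Q) (G : PSCDatum Q),
      IsProSigmaCompletion {l} ι ∧ G.Sigma = {l} ∧ Nonempty (G.graph.C ≃ Fin 1) ∧
      (∀ c, IsMaximalCuspidalCandidate l ⟨fun V => G.cuspCount V - 1⟩ (G.cuspGp c)) ∧
      (∀ I : Subgroup Q, G.IsCuspidal I ↔
        IsMaximalCuspidalCandidate l ⟨fun V => G.cuspCount V - 1⟩ I) := by
  obtain ⟨Q, ι, G, hι, hS, -, -, ⟨e, -⟩, -, hmax, hiff, -⟩ :=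
    exists_smoothCurve_lem45iv_model l hl 1 1
      (by unfold PuncturedSurfaceGroup.IsHyperbolicType; norm_num) Nat.one_pos
  exact ⟨Q, ι, G, hι, hS, ⟨e⟩, hmax, hiff⟩

/-- **FACT-LIST F-0216 (`SatisfiesCuspidalCriterion`) and F-0213 (`IsMaximalCuspidalCandidate`) are
MODEL-WITNESSED at genuine data**: for every prime `l` there are a profinite group `H_*`, cusp-count data
`d` and a subgroup `I ⊆ H_*` (a genuine cusp inertia group of a pro-`l` surface group) with
`SatisfiesCuspidalCriterion l d I` and `IsMaximalCuspidalCandidate l d I`.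
[cite: MochizukiAbsTopI2012, Lemma 4.5 (iv) p.54] -/
theorem exists_satisfiesCuspidalCriterion_genuine (l : ℕ) (hl : l.Prime) :
    ∃ (Hstar : ProfiniteGrp.{0}) (d : CuspCountData Hstar) (I : Subgroup Hstar),
      SatisfiesCuspidalCriterion l d I ∧ IsMaximalCuspidalCandidate l d I := by
  obtain ⟨Q, -, G, -, -, ⟨e⟩, hmax, -⟩ := exists_oncePunctured_lem45iv_model l hl
  exact ⟨Q, _, G.cuspGp (e.symm 0), (hmax _).1, hmax _⟩

end Literature.AnabelianGeometry.AbsoluteAnabelian.FundamentalExtension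

end
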